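import Literature.NumberTheory.Transcendental.L2HodgeTheory
import Literature.NumberTheory.Transcendental.FormIntegrationBridgeProofs
import Literature.Geometry.Kaehler.HodgeStarInnerDefiniteProofs
import HarnessLib

/-!
# The vendored fact `MForm.l2Inner_self_eq_zero_iff` is false as stated (counterexample)

`Literature.Geometry.Kaehler.MForm.l2Inner_self_eq_zero_iff`
(`Literature/NumberTheory/Transcendental/L2HodgeTheory.lean`, Warner (1983), 6.1) was meant to
say: on a *closed* oriented Riemannian manifold, `⟪α, α⟫_{L²} = 0 ↔ α = 0` for smooth forms `α`.
It is a `def … : Prop` written under `section Closed` variables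
`[CompactSpace M] [I.Boundaryless] [IsContinuousRiemannianBundle …] [IsContMDiffRiemannianBundle …]`,
but a definition only abstracts the section variables its body uses, so none of these is part of
the stated `Prop`: as elaborated it quantifies over every `σ`-compact Hausdorff `C^∞` manifold
with an arbitrary fibrewise inner product. This file records that the statement is then false,
so that the fact is not re-filed in this form; the corrected, proved statement is
`MForm.l2Inner_self_eq_zero_iff_of_compactSpace` (`L2HodgeTheoryDefiniteProofs.lean`).

## The counterexample

`M = ℕ` (discrete: Hausdorff, `σ`-compact, not compact), modelled on `ℝ⁰ = Fin 0 → ℝ` with the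
charts of `ChartedSpace.of_discreteTopology` (the chart at `i` has source `{i}`), a `C^∞` manifold
(`IsManifold.of_discreteTopology`); the zero Riemannian metric on `T_iℕ = ℝ⁰`; the positive
orientation at every point; `k = 0` and `α` the constant `0`-form `1 ≠ 0`. In
`MForm.integral = ∑ᶠ i, ∫_{chart target} chartSign · ρᵢ ∘ chart⁻¹ · (⟪α, α⟫ vol)^_i (e)`, the
partition of unity subordinate to the chart sources has `ρᵢ(i) = 1`, and every chart integral is
a non-zero constant (integrand `sign · 1 · ⟪α_i, α_i⟫ · vol_i ≠ 0` on the one-point target of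
Haar mass `> 0`); the support of the summand is all of `ℕ`, so the `finsum` is its junk value `0`:
`⟪α, α⟫_{L²} = 0` although `α ≠ 0`.

## References

* F. W. Warner, *Foundations of Differentiable Manifolds and Lie Groups*, GTM 94 (1983), 6.1,
  p. 220 ("Throughout this chapter, M will be a compact oriented Riemannian manifold").

## Verdict clean-up note (2026-08-15)

The named fact `MForm.l2Inner_self_eq_zero_iff` is now an `@[deprecated]` record of
`L2HodgeTheory.lean` (mis-stated, resp. refuted as stated: a `def` does not abstract the unused
section instances it was written under; the corrected statements are the ones proved or named in
this file and in the records' docstrings). The declaration `not_l2Inner_self_eq_zero_iff` names the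
record on purpose, so `linter.deprecated` is silenced on exactly that declaration (REMOVE-WHEN the
records are deleted from `L2HodgeTheory.lean`).
-/

noncomputable section

open scoped Manifold ContDiff Topology
open Bundle Module Set MeasureTheory Literature.Geometry.Kaehler

namespace Literature.NumberTheory.Transcendental

namespace L2HodgeTheoryCounterexample

-- The identification `TangentSpace I x = E` is an abuse of definitional equality; as in Mathlib's
-- tangent-bundle files we let `isDefEq` unfold it.
set_option backward.isDefEq.respectTransparency false

/-- The zero-dimensional model space `ℝ⁰`. [folklore] -/
abbrev E0 : Type := Fin 0 → ℝ

/-- `finrank ℝ ℝ⁰ = 0`. [folklore] -/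
local instance instFactFinrankE0 : Fact (finrank ℝ E0 = 0) := ⟨Module.finrank_fin_fun ℝ⟩

attribute [local instance] ChartedSpace.of_discreteTopology

/-- The discrete space `ℕ` is a `C^∞` manifold modelled on `ℝ⁰` (Mathlib's
`IsManifold.of_discreteTopology`, charts `ChartedSpace.of_discreteTopology`). [folklore] -/
local instance instIsManifoldNat : IsManifold 𝓘(ℝ, E0) ∞ ℕ := IsManifold.of_discreteTopology _

/-- The tangent spaces `T_xℕ = ℝ⁰` are points. [folklore] -/
local instance instSubsingletonTangentSpace (x : ℕ) : Subsingleton (TangentSpace 𝓘(ℝ, E0) x) :=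
  inferInstanceAs (Subsingleton E0)

/-- The (unique: zero) Riemannian metric on the tangent spaces `T_xℕ = ℝ⁰`. [folklore] -/
def zeroMetric : RiemannianMetric (fun x : ℕ ↦ TangentSpace 𝓘(ℝ, E0) x) where
  inner _ := 0
  symm _ _ _ := rfl
  pos _ v hv := (hv (Subsingleton.elim v 0)).elim
  continuousAt _ := continuousAt_const
  isVonNBounded x :=
    (Bornology.isVonNBounded_singleton (0 : TangentSpace 𝓘(ℝ, E0) x)).subset fun v _ ↦
      Set.mem_singleton_iff.2 (Subsingleton.elim v 0)

/-- `ℕ` as a Riemannian manifold (zero metric on `ℝ⁰`). [folklore] -/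
local instance instRiemannianBundleNat : RiemannianBundle (fun x : ℕ ↦ TangentSpace 𝓘(ℝ, E0) x) :=
  ⟨zeroMetric⟩

/-- The orientation family on `ℕ`: the positive orientation of `ℝ⁰` at every point. [folklore] -/
def o0 : (x : ℕ) → Orientation ℝ (TangentSpace 𝓘(ℝ, E0) x) (Fin 0) := fun _ ↦ positiveOrientation

/-- Every form on the `0`-dimensional manifold `ℕ` is smooth (chart representatives are functions
on the point `ℝ⁰`). [folklore] -/
theorem isSmoothForm_nat {k : ℕ} (β : MForm 𝓘(ℝ, E0) ℕ ℝ k) : IsSmoothForm β := fun x ↦ by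
  have h : β.inChart x = fun _ ↦ β.inChart x (extChartAt 𝓘(ℝ, E0) x x) :=
    funext fun y ↦ congrArg (β.inChart x) (Subsingleton.elim _ _)
  rw [h]
  exact contDiffWithinAt_const

/-- A non-zero alternating form in zero variables does not vanish at any (the) argument.
[folklore] -/
theorem apply_ne_zero_of_isEmpty {V : Type*} [AddCommGroup V] [Module ℝ V]
    {f : V [⋀^Fin 0]→ₗ[ℝ] ℝ} (hf : f ≠ 0) (v : Fin 0 → V) : f v ≠ 0 := fun hv ↦
  hf (AlternatingMap.ext fun w ↦ (congrArg f (Subsingleton.elim w v)).trans hv)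

/-- The partition of unity subordinate to the one-point chart sources of `ℕ` is `ρᵢ(i) = 1`.
[folklore] -/
theorem chartPartitionOfUnity_self (i : ℕ) : chartPartitionOfUnity 𝓘(ℝ, E0) ℕ i i = 1 := by
  have hsum := (chartPartitionOfUnity 𝓘(ℝ, E0) ℕ).sum_eq_one (Set.mem_univ i)
  rwa [finsum_eq_single _ i] at hsum
  intro j hj
  by_contra h
  have hi : i ∈ (chartAt E0 j).source :=
    chartPartitionOfUnity_isSubordinate j (subset_tsupport _ (Function.mem_support.2 h))
  exact hj (Set.mem_singleton_iff.1 hi).symm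

-- names the `@[deprecated]` record `MForm.l2Inner_self_eq_zero_iff` on purpose (verdict clean-up 2026-08-15); REMOVE-WHEN the
-- record is deleted from `L2HodgeTheory.lean`
set_option linter.deprecated false in
/-- **`MForm.l2Inner_self_eq_zero_iff` (as vendored, without compactness) is false**: it fails
for `M = ℕ` (discrete, modelled on `ℝ⁰`, zero metric, positive orientation), `k = 0`: the
constant `0`-form `1` is smooth and non-zero but has `⟪1, 1⟫_{L²} = 0`, because every one of the
infinitely many chart integrals in `MForm.integral` is non-zero, so the `finsum` is its junk value
`0`. Warner (1983), 6.1 assumes `M` compact (GTM 94, p. 220). [cite: WarnerGTM94, 6.1, p. 220] -/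
theorem not_l2Inner_self_eq_zero_iff : ¬ MForm.l2Inner_self_eq_zero_iff o0 (k := 0) := by
  classical
  intro h
  set α : MForm 𝓘(ℝ, E0) ℕ ℝ 0 := fun x ↦
    ContinuousAlternatingMap.constOfIsEmpty ℝ (TangentSpace 𝓘(ℝ, E0) x) (Fin 0) (1 : ℝ) with hα
  have hαx : ∀ x, α x ≠ 0 := fun x hx ↦ by
    have h1 := congrArg (fun f : TangentSpace 𝓘(ℝ, E0) x [⋀^Fin 0]→L[ℝ] ℝ ↦ f isEmptyElim) hx
    simp [α] at h1
  -- every chart integral of `⟪α, α⟫_{L²}` is non-zero, so the `finsum` over `ℕ` vanishes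
  have hint : MForm.l2Inner o0 α α = 0 := by
    change ∑ᶠ i : ℕ, ∫ y in (extChartAt 𝓘(ℝ, E0) i).target,
      chartSign o0 i y * chartPartitionOfUnity 𝓘(ℝ, E0) ℕ i ((extChartAt 𝓘(ℝ, E0) i).symm y) *
        MForm.inChart (fun x ↦ MForm.inner 0 α α x • riemannianVolumeForm o0 x) i y
          (modelBasis E0 0) ∂(modelBasis E0 0).addHaar = 0
    refine finsum_of_infinite_support (Set.infinite_univ.mono fun i _ ↦ ?_)
    rw [Function.mem_support]
    set d : E0 := extChartAt 𝓘(ℝ, E0) i i with hd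
    set F : E0 → ℝ := fun y ↦
      chartSign o0 i y * chartPartitionOfUnity 𝓘(ℝ, E0) ℕ i ((extChartAt 𝓘(ℝ, E0) i).symm y) *
        MForm.inChart (fun x ↦ MForm.inner 0 α α x • riemannianVolumeForm o0 x) i y
          (modelBasis E0 0) with hF
    -- the integrand is the constant `F d` on the target, which is all of the point `ℝ⁰`
    have hconst : F = fun _ ↦ F d := funext fun y ↦ congrArg F (Subsingleton.elim y d)
    have htarget : (extChartAt 𝓘(ℝ, E0) i).target = univ :=
      Set.eq_univ_of_forall fun y ↦ (Subsingleton.elim d y) ▸ mem_extChartAt_target i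
    change ∫ y in (extChartAt 𝓘(ℝ, E0) i).target, F y ∂(modelBasis E0 0).addHaar ≠ 0
    rw [hconst, setIntegral_const, htarget, smul_eq_mul]
    refine mul_ne_zero ?_ ?_
    · -- the Haar measure of the point is positive and finite
      rw [measureReal_def, ENNReal.toReal_ne_zero]
      exact ⟨(isOpen_univ.measure_pos _ univ_nonempty).ne',
        (Set.subsingleton_univ.isCompact.measure_lt_top).ne⟩
    · -- the integrand at the point: `sign(o(e)) · ρᵢ(i) · (⟪α_i, α_i⟫ · vol_i(e)) ≠ 0`
      have hsymm : (extChartAt 𝓘(ℝ, E0) i).symm d = i := rfl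
      rw [hF]
      dsimp only
      rw [hsymm, chartPartitionOfUnity_self, mul_one]
      refine mul_ne_zero ?_ ?_
      · -- the chart sign is the sign of a non-zero `0`-form of `T_iℕ`
        change Real.sign ((o0 ((extChartAt 𝓘(ℝ, E0) i).symm d)).someVector _) ≠ 0
        rw [Ne, Real.sign_eq_zero_iff]
        exact apply_ne_zero_of_isEmpty (Module.Ray.someVector_ne_zero _) _
      · rw [MForm.inChart_apply, hsymm, ContinuousAlternatingMap.smul_apply, smul_eq_mul]
        refine mul_ne_zero (fun h0 ↦ hαx i ?_) ?_
        · exact (alternatingFormInner_self_eq_zero_iff_holds 0 (α i)).1 h0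
        · rw [riemannianVolumeForm_apply, Orientation.volumeFormL_apply]
          exact apply_ne_zero_of_isEmpty (volumeForm_ne_zero (o0 i)) _
  exact hαx 0 (congrFun ((h (isSmoothForm_nat _) (isSmoothForm_nat α)).1 hint) 0)

end L2HodgeTheoryCounterexample

end Literature.NumberTheory.Transcendental
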